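import Summits.HubbardSuperconductivity.HubbardSuperconductivity.Theorems.WeakCouplingBCSKlLindhardEnclosureCeilBdry
import Summits.HubbardSuperconductivity.HubbardSuperconductivity.Theorems.WeakCouplingBCSKlLindhardEnclosureFloorBdry
import Summits.HubbardSuperconductivity.HubbardSuperconductivity.Theorems.WeakCouplingBCSKlLindhardEnclosureTipSound
import Summits.HubbardSuperconductivity.HubbardSuperconductivity.Theorems.WeakCouplingBCSKlLindhardEnclosureW20OfRulesOrd

/-!
# KL-MARGIN-SCAN reader (22) «kernel-lindhard-enclosure» — THE INSTRUMENT IS SOUND: `kernel_sound : ∀ P t, FloorSoundAt P t ∧ CeilSoundAt P t`, and the `W20` enclosure of `χ₀` unconditionally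

Capstone of the (22) soundness debt (crux item stmt-0158, reader idea-4 r11): the two named predicates of the gate theorems
(`…LindhardEnclosureGate.FloorSoundAt` / `CeilSoundAt` — the fused kernel's floor resp. ceiling term of EVERY leaf of EVERY certificate tree
bounds `2^30 ×` the true cell integral of the two-shell integrand from below resp. above) HOLD for every parameter record and every tree:
* `ceilSoundAt_holds` — from the majorised-hyperbola rule `…CeilBdry.ceilBdrySoundOrd` (this lineage) and the tip rule `…TipSound.ceilTipSoundOrd`
  (seat p4 g25) via `…Chord.ceilSoundAt_of_two_rules` (crude + chord rules inside);
* `floorSoundAt_holds` is `…FloorBdry.floorSoundAt_holds` (Jensen floor + boundary floor);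
* hence `kernel_sound`, the unconditional containment gate `hull_contains_holds`, and the certificate instance
  **`W20_enclosure_holds : 13934968926/(2^30·(2·piUpQ)²) ≤ χ₀(P_W20) ≤ 14677221910/(2^30·(2·piLoQ)²)`** (`≈ 0.3287 ≤ χ₀(q_W20; t′ = −2399/2500,
  μ = −3/10) ≤ 0.3462`), i.e. `…CertW20C.W20_enclosure` with both hypotheses discharged.
Honest framing: this certifies ONE Lindhard-function enclosure produced by the integer kernel (and the kernel's soundness in general); floats
remain floats elsewhere; nothing here asserts a KL margin at any `t′ ≠ 0`, a channel order, `K₃`, `U₀`, the window or B1g dominance; a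
Kohn–Luttinger `O(U²)` channel statement is not ODLRO and nothing in this file proves superconductivity in the Hubbard model.  (p1 g26, 2026-08-29.)
-/

noncomputable section

set_option linter.dupNamespace false

namespace Summit.HubbardSuperconductivity.HubbardSuperconductivity.Theorems.KlLindhardEnclosure

open Real Set MeasureTheory Literature.MathematicalPhysics.QuantumLattice
open Summit.HubbardSuperconductivity.HubbardSuperconductivity.Theorems

/-- **`CeilSoundAt P t` for every parameter record and every certificate tree** (all ceiling rules are tree theorems). -/
theorem ceilSoundAt_holds (P : Params) (t : QB) : CeilSoundAt P t :=
  ceilSoundAt_of_two_rules P (ceilBdrySoundOrd P) (ceilTipSoundOrd P) t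

/-- **THE (22) INSTRUMENT IS SOUND**: `FloorSoundAt P t ∧ CeilSoundAt P t` for every `P` and every tree `t`. -/
theorem kernel_sound (P : Params) (t : QB) : FloorSoundAt P t ∧ CeilSoundAt P t :=
  ⟨floorSoundAt_holds P t, ceilSoundAt_holds P t⟩

/-- The five ORIENTED rule predicates all hold (the hypotheses of `…W20OfRulesOrd`, discharged). -/
theorem five_rulesOrd_hold (P : Params) :
    FloorInsideSoundOrd P ∧ FloorBdrySoundOrd P ∧ CeilChordSoundOrd P ∧ CeilBdrySoundOrd P ∧ CeilTipSoundOrd P :=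
  ⟨floorInsideSoundOrd P, floorBdrySoundOrd P, ceilChordSoundOrd P, ceilBdrySoundOrd P, ceilTipSoundOrd P⟩

/-- **THE CONTAINMENT GATE, UNCONDITIONALLY**: for admissible `P`, a hull row `[lo, hi]` confirmed by the kernel's root evaluation of ANY
certificate tree holds for the true `χ₀(P)`. -/
theorem hull_contains_holds (P : Params) (t : QB) (hP : P.admissible = true) (Nf Nc : ℤ) (hE : P.rootEval t = (Nf, some Nc)) (lo hi : ℚ)
    (hlo : lo * (2 ^ 30 * (2 * KlStair.piUpQ) ^ 2) ≤ Nf) (hhi : (Nc : ℚ) ≤ hi * (2 ^ 30 * (2 * FSPoly.piLoQ) ^ 2)) :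
    ((lo : ℚ) : ℝ) ≤ P.chi ∧ P.chi ≤ ((hi : ℚ) : ℝ) :=
  hull_contains P t (floorSoundAt_holds P t) (ceilSoundAt_holds P t) hP Nf Nc hE lo hi hlo hhi

/-- **THE `W20` ENCLOSURE OF `χ₀`, UNCONDITIONALLY**: `13934968926/(2^30·(2·piUpQ)²) ≤ χ₀(P_W20) ≤ 14677221910/(2^30·(2·piLoQ)²)`
(`…CertW20C.W20_enclosure` with `FloorSoundAt P_W20 T_W20` and `CeilSoundAt P_W20 T_W20` now theorems). -/
theorem W20_enclosure_holds :
    ((13934968926 : ℤ) : ℝ) / (2 ^ 30 * (2 * ((KlStair.piUpQ : ℚ) : ℝ)) ^ 2) ≤ P_W20.chi ∧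
    P_W20.chi ≤ ((14677221910 : ℤ) : ℝ) / (2 ^ 30 * (2 * ((FSPoly.piLoQ : ℚ) : ℝ)) ^ 2) :=
  W20_enclosure (floorSoundAt_holds P_W20 T_W20) (ceilSoundAt_holds P_W20 T_W20)

/-- **EVERY KERNEL ENCLOSURE IS A TRUE ENCLOSURE, UNCONDITIONALLY** (`…Gate.lindhard_mem_enclosure` with both soundness hypotheses
discharged): for admissible `P` and ANY certificate tree `t` whose root evaluation is `(Nf, some Nc)`,
`Nf/(2^30·(2·piUpQ)²) ≤ χ₀(P) ≤ Nc/(2^30·(2·piLoQ)²)`.  This is the one-line consumer for future certificate points: evaluate the kernel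
(`P.rootEval t` by `decide`/`rfl`) and apply. -/
theorem lindhard_mem_enclosure_holds (P : Params) (t : QB) (hP : P.admissible = true) (Nf Nc : ℤ) (hE : P.rootEval t = (Nf, some Nc)) :
    ((Nf : ℤ) : ℝ) / (2 ^ 30 * (2 * ((KlStair.piUpQ : ℚ) : ℝ)) ^ 2) ≤ P.chi ∧
    P.chi ≤ ((Nc : ℤ) : ℝ) / (2 ^ 30 * (2 * ((FSPoly.piLoQ : ℚ) : ℝ)) ^ 2) :=
  lindhard_mem_enclosure P t (floorSoundAt_holds P t) (ceilSoundAt_holds P t) hP Nf Nc hE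

end Summit.HubbardSuperconductivity.HubbardSuperconductivity.Theorems.KlLindhardEnclosure

end
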